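/-
Copyright (c) 2026 the pub-hodgecm-mathlib formalisation cell (harness21).  Prover seat hodgecm-mathlib-K2E5-p17 (g6), Track B «K2-LIT» ∕ h413
(`stmt-HodgeConjecture-24833`), line `K2_E3_EllipticInputs`, road «GL₂-sc» (road owner lineage K2E5-p17; dealer D66), brick (2A-2) ED. 3: THE HYPOTHESIS-FREE
CLOSER — Harish-Chandra's local integrability for SUPERCUSPIDAL `GL₂(F)`, all inputs ★.  2026-09-04.
-/
import Summits.HodgeConjecture.HodgeConjecture.Theorems.K2E3GL2SupercuspidalCharLocInt         -- ★ 2A-2 p858988 + ED. 2 p859030 (K2E5-p17 (g5)): `charLocIntNear_gl2_supercuspidal_of_nonell (hNE₂)`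
import Summits.HodgeConjecture.HodgeConjecture.Theorems.K2E3GL2ModUniformizerNonEllEstimates    -- ★ 2N-7 F4 p859268 (K2E3-p23 (g6)): `nonEllEstimates_modUniformizer` = `hNE₂` VERBATIM
import HarnessLib

/-!
# Road «GL₂-sc», brick (2A-2) ED. 3: Harish-Chandra's local integrability for SUPERCUSPIDAL `GL₂(F)` — the HYPOTHESIS-FREE closer

Cell `pub/hodgecm-mathlib` (D-0151), Track B, seat K2E5-p17 (g6) (heir of the road owner «GL₂-sc» K2E5-p17 (g5); dealer K2E3-plan (g4) RULINGS #1 (R-2), deal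
D66; BRICK LIST v1.1 `K2/K2E5-p17/g5/BRICKLIST-GL2sc-v1.1.K2E5-p17-g5.md`).  `--supports stmt-HodgeConjecture-24833 --as helper`; THEOREMS ONLY (no definition ∕
instance ∕ notation ∕ named fact ∕ `sorry`); never imports `Cruxes/…/Lines`.  COUNT-NEUTRAL.

WHY A SEPARATE FILE: the ED. 3 one-liner announced in ★ 2A-2's module docstring cannot be APPENDED to `K2E3GL2SupercuspidalCharLocInt` — the NE leaf
`K2E3GL2ModUniformizerNonEllEstimates` imports it transitively (`… ← K2E3GL2NonEllWeightLocIntegrable ← K2E3GL2ModUniformizerLocIntTransfer ← K2E3GL2SupercuspidalCharLocInt`),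
so the import would close a cycle (`lint.import-cycle`).  This module sits ABOVE both and exports the hypothesis-free theorem for `Theorems/`-side consumers (who may
not import the `Lines/` socket `U12Characters.sig_K2E3GL2SupercuspidalCharLocInt`, ★-tied end-to-end in U12 ED. 27 with the same body).

* **`charLocIntNear_gl2_supercuspidal`** — for `F` a non-archimedean local field of characteristic `0`, `μ` a Haar measure on `GL₂(F)` and `ρ` an irreducible smooth
  admissible SUPERCUSPIDAL representation of `GL₂(F)` on a complex vector space `V`, the distribution character `f ↦ tr ρ(f)` is, near every `g ∈ GL₂(F)`, given by a
  locally integrable function: `∃ U ∋ g` open, `∃ Θ ∈ L¹(U, μ)`, `tr ρ(f) = ∫ f·Θ dμ` for every Schwartz–Bruhat `f` supported in `U`.  Statement = the bytes of the hosted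
  leaf (S-C′-GL₂sc) `sig_K2E3GL2SupercuspidalCharLocInt` VERBATIM (`ValuativeRel` frame, Representation form, ∀-closed over `F V : Type`).
  Proof: ★ ED. 2 `charLocIntNear_gl2_supercuspidal_of_nonell` fed with ★ 2N-7 `nonEllEstimates_modUniformizer` (its `hNE₂` binder token for token).

Chain behind it (all ★, road «GL₂-sc»): FRAME 2F-a…2F-v · ELLIPTIC 2E-a1…a5, 2E-b1, 2E-b2, 2E-c (Harish-Chandra Part VII Thm 14 ∕ `(FC)` at `N = 2`) · 2A-1
`K2E3GL2ModCocompactCharLocInt` (Thm 16 on `GL₂(F) ⧸ ϖ^ℤ·1` ⟸ `hNE₂`) · NON-ELLIPTIC 2N-0…2N-7 (Thms 15, 18–20 at `N = 2`: one split torus, one parabolic) · 2A-2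
(twist–descend–transport–untwist).

HONEST LABEL: HC_CM is proved only modulo the 7 printed citations (2 remaining named inputs: hLiu418 = stmt-HodgeConjecture-24832, h413 =
stmt-HodgeConjecture-24833) until rung 0 closes; count-neutral (kernel lane).  This theorem itself is UNCONDITIONAL (no named-fact hypothesis).

References: Harish-Chandra (van Dijk) 1970, Part VII Thm 16 p. 67, Thms 18–20 pp. 69–70, Thm p. 99 [cite: HarishChandra1970, Part VII Thm 16 p. 67];
Harish-Chandra 1999 (DeBacker–Sally), Thm 16.3 p. 77 [cite: HarishChandra1999AdmissibleDistributions, Thm. 16.3 p. 77]; Jacquet–Langlands 1970 §7 (supercuspidal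
matrix coefficients of `GL₂`) [cite: JacquetLanglands1970, §7]; Bushnell–Henniart 2006 §9.1 [cite: BushnellHenniart2006, §9.1].
-/

open MeasureTheory MeasureTheory.Measure Set Filter
open scoped MatrixGroups Topology
open Literature.NumberTheory.Automorphic Literature.NumberTheory.GaloisRepresentations Literature.NumberTheory.GaloisRepresentations.IsNonarchimedeanLocalField

set_option autoImplicit false
set_option linter.dupNamespace false   -- `Summit.HodgeConjecture.HodgeConjecture.…` (D-0017 nested layout; lakefile exemption for Summits)

noncomputable section

namespace Summit.HodgeConjecture.HodgeConjecture.Cruxes.H413.K2E3GL2SupercuspidalCharLocIntFinal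

/-- **(GL₂-sc) HARISH-CHANDRA'S LOCAL INTEGRABILITY OF SUPERCUSPIDAL CHARACTERS OF `GL₂(F)` — HYPOTHESIS-FREE.**  For `F` a non-archimedean local field of
characteristic `0` (`ValuativeRel` frame), `μ` a Haar measure on `GL₂(F)`, and `ρ` an irreducible, smooth, admissible, supercuspidal complex representation of
`GL₂(F)`: every `g ∈ GL₂(F)` has an open neighbourhood `U` and a function `Θ`, integrable on `U`, such that `ρ.smoothTrace μ f = ∫ f·Θ dμ` for every Schwartz–Bruhat
`f` with `tsupport f ⊆ U`.  Statement = the hosted leaf (S-C′-GL₂sc) `U12Characters.sig_K2E3GL2SupercuspidalCharLocInt` VERBATIM; proof = ★ (2A-2) ED. 2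
`charLocIntNear_gl2_supercuspidal_of_nonell` at ★ (2N-7) `K2E3GL2ModUniformizerNonEllEstimates.nonEllEstimates_modUniformizer` (the same body U12 ED. 26∕27 uses on the
`Lines/` side).  [cite: HarishChandra1970, Part VII Thm 16 p. 67, Thms 18–20 pp. 69–70] [cite: HarishChandra1999AdmissibleDistributions, Thm. 16.3 p. 77]
[cite: JacquetLanglands1970, §7] -/
theorem charLocIntNear_gl2_supercuspidal :
    ∀ (F : Type) [Field F] [ValuativeRel F] [TopologicalSpace F] [IsNonarchimedeanLocalField F] [CharZero F]
      [MeasurableSpace (GL (Fin 2) F)] [BorelSpace (GL (Fin 2) F)] (μ : Measure (GL (Fin 2) F)) [μ.IsHaarMeasure]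
      (V : Type) [AddCommGroup V] [Module ℂ V] (ρ : Representation ℂ (GL (Fin 2) F) V) [ρ.IsIrreducible],
      ρ.IsSmooth → ρ.IsAdmissible → ρ.IsSupercuspidal → ∀ g : GL (Fin 2) F,
        ∃ U : Set (GL (Fin 2) F), IsOpen U ∧ g ∈ U ∧ ∃ Θ : GL (Fin 2) F → ℂ, IntegrableOn Θ U μ ∧
          ∀ f : GL (Fin 2) F → ℂ, f ∈ SchwartzBruhat (GL (Fin 2) F) → tsupport f ⊆ U → ρ.smoothTrace μ f = ∫ x, f x * Θ x ∂μ :=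
  K2E3GL2SupercuspidalCharLocInt.charLocIntNear_gl2_supercuspidal_of_nonell K2E3GL2ModUniformizerNonEllEstimates.nonEllEstimates_modUniformizer

/-- **Pointed form** of `charLocIntNear_gl2_supercuspidal` (instance binders, one representation, one point) — the shape `Theorems/`-side consumers `obtain` from.
[cite: HarishChandra1970, Part VII Thm 16 p. 67] -/
theorem charLocIntNear_gl2_supercuspidal_at {F : Type} [Field F] [ValuativeRel F] [TopologicalSpace F] [IsNonarchimedeanLocalField F] [CharZero F]
    [MeasurableSpace (GL (Fin 2) F)] [BorelSpace (GL (Fin 2) F)] (μ : Measure (GL (Fin 2) F)) [μ.IsHaarMeasure]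
    {V : Type} [AddCommGroup V] [Module ℂ V] (ρ : Representation ℂ (GL (Fin 2) F) V) [ρ.IsIrreducible]
    (hs : ρ.IsSmooth) (ha : ρ.IsAdmissible) (hsc : ρ.IsSupercuspidal) (g : GL (Fin 2) F) :
    ∃ U : Set (GL (Fin 2) F), IsOpen U ∧ g ∈ U ∧ ∃ Θ : GL (Fin 2) F → ℂ, IntegrableOn Θ U μ ∧
      ∀ f : GL (Fin 2) F → ℂ, f ∈ SchwartzBruhat (GL (Fin 2) F) → tsupport f ⊆ U → ρ.smoothTrace μ f = ∫ x, f x * Θ x ∂μ :=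
  charLocIntNear_gl2_supercuspidal F μ V ρ hs ha hsc g

end Summit.HodgeConjecture.HodgeConjecture.Cruxes.H413.K2E3GL2SupercuspidalCharLocIntFinal

end
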